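import Mathlib
import Summits.ValiantsHypothesis.ValiantsHypothesis.Theorems.GrenetZeonTwoDimCoefficientsDualUnipotentThinNumeratorGauge
import Summits.ValiantsHypothesis.ValiantsHypothesis.Theorems.GrenetZeonTwoDimCoefficientsDualUnipotentJordanGauge

/-!
# Crux `GrenetZeon.TwoDimCoefficients` (stmt-ValiantsHypothesis-8062) / rung `DualUnipotentThreeHalves` (stmt-24318):
# the Jordan gauge lemma — part 2, the JORDAN-GAUGED THIN-NUMERATOR HESSIAN BOUND

Part 1 (✓ `…DualUnipotentJordanGauge`) proves the Jordan gauge lemma: for every square matrix `A` over `ℂ` and every `Y`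
there is a constant `G` with `rank(Y + (A·G − G·A)) ≤ ν(A) := dim Σ_μ Eig_μ(A)` (the total number of Jordan blocks of `A`;
for nilpotent `N`: `rank(Y + [N, G]) + rank N ≤ m`).  This file plugs it into the gauged thin-numerator bound
✓ `rank_hess0_transl_trace_adjugate_mul_le_numerator_gauge` (✓ `…ThinNumeratorGauge`, 12th hand) and into its two
readings:

* ★★ `exists_rank_hess0_transl_trace_adjugate_mul_le_jordan` — for affine `A`, `B` with `det A ≡ c ≠ 0` and EVERY point `p`,
  SOME constant `G` gives `rank Hess_p tr(adj A·B) ≤ 2·m·ν(A(p)) + 2·rank coeff(B + (A·G − G·A))`;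
* ★ `exists_sq_le_jordan_of_repr` — per side at the Mignon–Ressayre point `p₀`: `per_n = α·det A + β·tr(adj A·B)`
  (`n = k + 3`) ⟹ `n² ≤ 2·m·ν(A(p₀)) + 2·rank coeff(B + (A·G − G·A))` for some `G`;
* ★ `exists_rank_hess0_transl_resolvent_le_jordan` — constrained-pencil currency: `N` affine with `N^m = 0`, `M` affine ⟹
  at every `p`, some `G` gives `rank Hess_p Σ_{j<m} tr(N^j·M) ≤ 2·m·(m − rank N(p)) + 2·rank coeff(M + (N·G − G·N))`,
  and `m − rank N(p) = dim ker N(p)` is the number of Jordan blocks of the nilpotent value `N(p)`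
  (`sum_trace_pow_mul_comm_eq_zero`: the resolvent trace is blind to a commutator numerator).

MEANING.  The pointwise term of the thin-numerator bound is now ALWAYS `≤ 2·m·#`Jordan blocks; the entire price of the
gauge is one typed quantity, the coefficient rank of the gauged numerator `B + [A, G]` — the place (R3′ of the g11 list)
where wild pencils with a fat numerator escape.  HONEST FRAMING: helper for an ASIDE crux; closes no stub —
`stub_dualUnipotent`, 24318, `stub_longMassSlowLawInv`, `VP ≠ VNP` untouched.  No definitions, no named facts, no sorry.
-/

noncomputable section

-- single-conjunct layout `Summits/ValiantsHypothesis/ValiantsHypothesis`: the duplicated namespace component is mandated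
set_option linter.dupNamespace false

namespace Summit.ValiantsHypothesis.ValiantsHypothesis.Theorems.GrenetZeon.JordanGauge

open Matrix Module

/-! ### §5 Plug-in: the Jordan-gauged thin-numerator Hessian bound -/

section Hessian

open MvPolynomial
open Literature.Computability.AlgebraicComplexity
open Summit.ValiantsHypothesis.ValiantsHypothesis.Theorems.GrenetZeon.ThinNumerator

variable {σ : Type*} [Fintype σ] [DecidableEq σ] {m : ℕ}

omit [Fintype σ] [DecidableEq σ] in
/-- Evaluating the gauged numerator: `(B + (A·G − G·A))(p) = B(p) + (A(p)·G − G·A(p))`. [folklore] -/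
theorem map_eval_gauge (A B : Matrix (Fin m) (Fin m) (MvPolynomial σ ℂ)) (G : Matrix (Fin m) (Fin m) ℂ)
    (p : σ → ℂ) :
    (B + (A * G.map (C : ℂ → MvPolynomial σ ℂ) - G.map (C : ℂ → MvPolynomial σ ℂ) * A)).map (eval p) =
      B.map (eval p) + (A.map (eval p) * G - G * A.map (eval p)) := by
  have hG : (G.map (C : ℂ → MvPolynomial σ ℂ)).map (eval p) = G := by
    rw [Matrix.map_map]
    have hc : (⇑(eval p) ∘ (C : ℂ → MvPolynomial σ ℂ)) = id := funext fun x => by simp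
    rw [hc, Matrix.map_id]
  have e : ∀ M : Matrix (Fin m) (Fin m) (MvPolynomial σ ℂ), M.map (eval p) = (eval p).mapMatrix M := fun M => rfl
  rw [e, map_add, map_sub, map_mul, map_mul, ← e, ← e, ← e, hG]

/-- ★★ **Jordan-gauged thin-numerator bound.**  For affine `A`, `B` with `det A ≡ c ≠ 0` and every point `p` there is
a constant matrix `G` with
`rank Hess_p tr(adj A·B) ≤ 2·m·ν(A(p)) + 2·rank coeff(B + (A·G − G·A))`,
where `ν(A(p)) = dim Σ_μ Eig_μ(A(p))` is the total number of Jordan blocks of the value `A(p)` (for `A(p) = 1 + N_p`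
with `N_p` nilpotent: `dim ker N_p`).  The pointwise term of ✓ `rank_hess0_transl_trace_adjugate_mul_le_numerator_gauge`
is thus always `≤ 2·m·ν`; the whole price of the gauge sits in the coefficient rank of the gauged numerator. [folklore] -/
theorem exists_rank_hess0_transl_trace_adjugate_mul_le_jordan (A B : Matrix (Fin m) (Fin m) (MvPolynomial σ ℂ))
    (hA : ∀ i j, (A i j).totalDegree ≤ 1) (hB : ∀ i j, (B i j).totalDegree ≤ 1) {c : ℂ} (hc : c ≠ 0)
    (hdet : A.det = C c) (p : σ → ℂ) :
    ∃ G : Matrix (Fin m) (Fin m) ℂ,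
      (hess0 (transl p (A.adjugate * B).trace)).rank ≤
        2 * (m * finrank ℂ (⨆ μ : ℂ, Module.End.eigenspace (A.map (eval p)).mulVecLin μ : Submodule ℂ (Fin m → ℂ))) +
          2 * (Matrix.of fun (lk : Fin m × Fin m) (t : σ) =>
            coeff (Finsupp.single t 1)
              ((B + (A * G.map (C : ℂ → MvPolynomial σ ℂ) - G.map (C : ℂ → MvPolynomial σ ℂ) * A)) lk.1 lk.2)).rank := by
  obtain ⟨G, hG⟩ := exists_rank_add_comm_le_finrank_iSup_eigenspace (A.map (eval p)) (B.map (eval p))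
  refine ⟨G, ?_⟩
  have h := rank_hess0_transl_trace_adjugate_mul_le_numerator_gauge A B hA hB hc hdet G 0 p
  simp only [map_zero, zero_smul, add_zero] at h
  rw [map_eval_gauge] at h
  exact h.trans (Nat.add_le_add_right (Nat.mul_le_mul_left 2 (Nat.mul_le_mul_left m hG)) _)

/-- ★ **Per-side reading at the Mignon–Ressayre point, Jordan-gauged.**  If `per_n = α·det A + β·tr(adj A·B)`
(`n = k + 3`) with `A`, `B` affine `m × m` and `det A ≡ c ≠ 0`, then for some constant `G`:
`n² ≤ 2·m·ν(A(p₀)) + 2·rank coeff(B + (A·G − G·A))`, `ν(A(p₀))` the number of Jordan blocks of `A(p₀)` at the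
Mignon–Ressayre point `p₀`. [folklore] -/
theorem exists_sq_le_jordan_of_repr (k : ℕ) {α β c : ℂ}
    (A B : Matrix (Fin m) (Fin m) (MvPolynomial (Fin (k + 3) × Fin (k + 3)) ℂ))
    (hA : ∀ i j, (A i j).totalDegree ≤ 1) (hB : ∀ i j, (B i j).totalDegree ≤ 1) (hc : c ≠ 0)
    (hdet : A.det = C c)
    (hper : perPoly (Fin (k + 3)) ℂ = C α * A.det + C β * (A.adjugate * B).trace) :
    ∃ G : Matrix (Fin m) (Fin m) ℂ,
      (k + 3) ^ 2 ≤
        2 * (m * finrank ℂ (⨆ μ : ℂ, Module.End.eigenspace (A.map (eval (mrPoint ℂ k))).mulVecLin μ : Submodule ℂ (Fin m → ℂ))) +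
          2 * (Matrix.of fun (lk : Fin m × Fin m) (t : Fin (k + 3) × Fin (k + 3)) =>
            coeff (Finsupp.single t 1)
              ((B + (A * G.map (C : ℂ → MvPolynomial (Fin (k + 3) × Fin (k + 3)) ℂ) -
                G.map (C : ℂ → MvPolynomial (Fin (k + 3) × Fin (k + 3)) ℂ) * A)) lk.1 lk.2)).rank := by
  obtain ⟨G, hG⟩ := exists_rank_add_comm_le_finrank_iSup_eigenspace
    (A.map (eval (mrPoint ℂ k))) (B.map (eval (mrPoint ℂ k)))
  refine ⟨G, ?_⟩
  have h := sq_le_numerator_gauge_of_repr k A B hA hB hc hdet hper G 0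
  simp only [map_zero, zero_smul, add_zero] at h
  rw [map_eval_gauge] at h
  exact h.trans (Nat.add_le_add_right (Nat.mul_le_mul_left 2 (Nat.mul_le_mul_left m hG)) _)

end Hessian

/-! ### §6 Plug-in, constrained-pencil (resolvent) currency -/

section Pencil

open MvPolynomial
open Literature.Computability.AlgebraicComplexity
open Summit.ValiantsHypothesis.ValiantsHypothesis.Theorems.GrenetZeon.ThinNumerator
open Summit.ValiantsHypothesis.ValiantsHypothesis.Cruxes.TwoDimCoefficients.DimTwoCases (AffMat IsAffine)

variable {n m : ℕ}

/-- The resolvent trace is blind to a commutator numerator: `Σ_{j<m} tr(N^j·(N·G − G·N)) = 0` termwise, since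
`tr(N^j·G·N) = tr(N^{j+1}·G)`. [folklore] -/
theorem sum_trace_pow_mul_comm_eq_zero (N G : AffMat n m) :
    ∑ j ∈ Finset.range m, (N ^ j * (N * G - G * N)).trace = 0 := by
  refine Finset.sum_eq_zero fun j _ => ?_
  rw [Matrix.mul_sub, Matrix.trace_sub, ← Matrix.mul_assoc, ← Matrix.mul_assoc,
    Matrix.trace_mul_cycle (N ^ j) G N, ← pow_succ', ← pow_succ, sub_self]

/-- The commutator-gauged pencil numerator `M + (N·G − G·N)` (`G` constant) is affine. [folklore] -/
theorem isAffine_add_comm (N M : AffMat n m) (hN : IsAffine N) (hM : IsAffine M) (G : Matrix (Fin m) (Fin m) ℂ) :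
    IsAffine (M + (N * G.map (C : ℂ → MvPolynomial (Fin n × Fin n) ℂ) -
      G.map (C : ℂ → MvPolynomial (Fin n × Fin n) ℂ) * N)) := fun i j => by
  simp only [Matrix.add_apply, Matrix.sub_apply]
  refine (totalDegree_add _ _).trans (max_le (hM i j) ?_)
  exact (totalDegree_sub _ _).trans
    (max_le (totalDegree_mul_map_C_le N hN G i j) (totalDegree_map_C_mul_le N hN G i j))

/-- ★ **Jordan-gauged thin-numerator bound, pencil currency.**  For an affine nilpotent pencil `N` (`N^m = 0`) and an
affine `M` over the `n²` coordinates, at every point `p` there is a constant `G` with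
`rank Hess_p (Σ_{j<m} tr(N^j·M)) ≤ 2·m·(m − rank N(p)) + 2·rank coeff(M + (N·G − G·N))`;
here `m − rank N(p) = dim ker N(p)` is the number of Jordan blocks of the nilpotent value `N(p)`. [folklore] -/
theorem exists_rank_hess0_transl_resolvent_le_jordan (N M : AffMat n m) (hN : IsAffine N) (hM : IsAffine M)
    (hnil : N ^ m = 0) (p : Fin n × Fin n → ℂ) :
    ∃ G : Matrix (Fin m) (Fin m) ℂ,
      (hess0 (transl p (∑ j ∈ Finset.range m, (N ^ j * M).trace))).rank ≤
        2 * (m * (m - (N.map (eval p)).rank)) +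
          2 * (Matrix.of fun (lk : Fin m × Fin m) (t : Fin n × Fin n) =>
            coeff (Finsupp.single t 1)
              ((M + (N * G.map (C : ℂ → MvPolynomial (Fin n × Fin n) ℂ) -
                G.map (C : ℂ → MvPolynomial (Fin n × Fin n) ℂ) * N)) lk.1 lk.2)).rank := by
  -- the value `N(p)` is nilpotent
  have e : ∀ X : AffMat n m, X.map (eval p) = (eval p).mapMatrix X := fun X => rfl
  have hnilp : IsNilpotent (N.map (eval p)) := ⟨m, by rw [e, ← map_pow, hnil, map_zero]⟩
  obtain ⟨G, hG⟩ := exists_rank_add_comm_le_card_of_isNilpotent hnilp (M.map (eval p))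
  refine ⟨G, ?_⟩
  set M' : AffMat n m := M + (N * G.map (C : ℂ → MvPolynomial (Fin n × Fin n) ℂ) -
    G.map (C : ℂ → MvPolynomial (Fin n × Fin n) ℂ) * N) with hM'
  -- the resolvent trace does not see the commutator
  have hsum : ∑ j ∈ Finset.range m, (N ^ j * M).trace = ∑ j ∈ Finset.range m, (N ^ j * M').trace := by
    rw [hM', ← sub_eq_zero, ← Finset.sum_sub_distrib]
    rw [← neg_eq_zero, ← Finset.sum_neg_distrib]
    rw [← sum_trace_pow_mul_comm_eq_zero N (G.map (C : ℂ → MvPolynomial (Fin n × Fin n) ℂ))]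
    refine Finset.sum_congr rfl fun j _ => ?_
    rw [Matrix.mul_add, Matrix.trace_add]
    ring
  rw [hsum]
  have h := rank_hess0_transl_resolvent_le_numerator N M' hN (isAffine_add_comm N M hN hM G) hnil p
  have hev : M'.map (eval p) = M.map (eval p) + (N.map (eval p) * G - G * N.map (eval p)) := by
    rw [hM']; exact map_eval_gauge N M G p
  rw [hev] at h
  have hcard : (M.map (eval p) + (N.map (eval p) * G - G * N.map (eval p))).rank ≤ m - (N.map (eval p)).rank := by
    have := hG; rw [Fintype.card_fin] at this; omega
  exact h.trans (Nat.add_le_add_right (Nat.mul_le_mul_left 2 (Nat.mul_le_mul_left m hcard)) _)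

end Pencil

end Summit.ValiantsHypothesis.ValiantsHypothesis.Theorems.GrenetZeon.JordanGauge

end
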